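import Literature.Computability.AlgebraicComplexity.MoreAsymmetricAssembly
import Literature.Computability.AlgebraicComplexity.GlobalStageCompatCount
import HarnessLib

/-!
# `p_compY` is well defined and Claim 5.17 as an exact double count
(Alman–Duan–Vassilevska Williams–Xu–Xu–Zhou 2025, Def. 5.15 and Claim 5.17) — proved

Topic `Literature/Computability/AlgebraicComplexity`.  §5.5 of Alman–Duan–Vassilevska Williams–Xu–Xu–
Zhou, *More asymmetry yields faster matrix multiplication* (SODA 2025, arXiv:2404.16349):

> **Definition 5.15 (`p_compY`).** For a fixed `Y_J` and a fixed typical `Y_Ĵ ∈ Y_J`, `p_compY` is the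
> probability of `Y_Ĵ` being compatible with a uniformly random block triple `X_I Y_J Z_K` consistent
> with `α`.  … It is not difficult to see that `p_compY` defined using `Y_Ĵ` is the same as `p_compY`
> defined using `Y_Ĵ'` … so it is well-defined.
> **Claim 5.17** [proof]: "(`P`) the number of tuples `(I, J, K, Ĵ)` where `X_I Y_J Z_K` is consistent
> with `α`, `Y_Ĵ ∈ Y_J` and `Y_Ĵ` is typical. (`Q`) … and additionally `Y_Ĵ` is compatible with the
> triple `X_I Y_J Z_K`.  Notice that by definition and by symmetry of different choices of `Y_Ĵ` and
> `Y_J`, `p_compY = Q/P`."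

This file PROVES the two "by symmetry" steps and the resulting exact identity — the `Y`-dimension
twin of `GlobalStageCompatCount.lean` (VXXZ Claim 5.14, `p_comp` for `Z`) — for the data
`D : GlobalStageData c n M` of one region whose set `𝒯α` of `α`-consistent triples is `S_n`-symmetric
(`GlobalStageData.Symmetric`, e.g. a joint type class):

* equivariance of `S_{*,j,*}`, `Y`-typicalness and `Y`-compatibility under `S_n`
  (`isTypicalY_comp_iff`, `isYCompatibleWith_comp_iff`);
* `compatCountY_eq_of_mem` — the number `C_Y` of level-1 `Y`-blocks `Y`-compatible with a triple of
  `𝒯α` does not depend on the triple (quantity `Q` per triple);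
* `letterCount_pairSeq_of_isTypicalY` — a typical pair `(J, Ĵ)` has a determined joint type
  (`#{t | J_t = j, Ĵ_t = σ} = β̄_{Y,*,j,*}(σ) · μ_Y(j)`, the paper's "their level-1 complete split
  distributions are the same"), so any two typical pairs differ by a permutation; hence
  (`card_compatTriplesY_eq_of_mem`) **the number `V_Y` of triples of `𝒯α` through `Y_J` that are
  `Y`-compatible with a typical `Ĵ ∈ Y_J` does not depend on `(J, Ĵ)`** — Def. 5.15 is well posed
  (`p_compY = V_Y · numyblock / numalpha`);
* `advxxz2025_claim517_count` — **the double count**: `V_Y · #{typical pairs} = |𝒯α| · C_Y` (both sides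
  count the pairs (triple of `𝒯α`, `Y`-compatible `Ĵ` in its `Y`-block): the printed `p_compY = Q/P`),
  with `#{typical pairs} = |typeClass n θ_Y|` for the joint type `θ_Y` of any typical pair
  (`card_typicalPairsY_eq`);
* `card_holePairsY_le` — consequently the `Y`-hole count `U_Y(T)` of `MoreAsymmetricHoles.lean` is at most
  `M_Y(T) · V_Y` ("the probability that `Y_Ĵ` is compatible with multiple triples in `𝒯_YComp` is at most
  `numalpha · p_compY / (numyblock · M₀)`", Claim 5.20, for each of the `M_Y(T)` useful — hence typical —
  blocks), turning the requirement `10 U_Y(T) M^{n−1} ≤ (h_Y+1) M^n` of `advxxz2025_prop51_region` into the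
  printed `M₀ ≥ (numalpha · p_compY / numyblock) · 80N`-type bound.

Everything is proved; the definitions are the counted sets; no named facts.  The product formula for
`C_Y` over the classes `{S_{i,j,0}} ∪ {S_{*,j,+}}` (the entropy exponent `η_Y` of Claim 5.17) is not part
of this file.

## References

* J. Alman, R. Duan, V. Vassilevska Williams, Y. Xu, Z. Xu, R. Zhou, *More asymmetry yields faster
  matrix multiplication*, SODA 2025, arXiv:2404.16349 (held: `paper:arxiv-2404.16349`, chunk p0019):
  Defs. 5.13, 5.15, Claim 5.17 and its proof, Claim 5.20. [AlmanDuanVassilevskaWilliamsXuXuZhou2025]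
* V. Vassilevska Williams, Y. Xu, Z. Xu, R. Zhou, *New bounds for matrix multiplication: from alpha
  to omega*, SODA 2024, arXiv:2307.07970, Def. 5.13 and Claim 5.14 (the `Z`-dimension original).
  [VassilevskaWilliamsXuXuZhou2024]
-/

noncomputable section

open scoped BigOperators
open Finset

namespace Literature.Computability.AlgebraicComplexity

/-! ## Equivariance of the `Y`-dimension notions under permutations of the positions -/

section Equivariance

variable {c n : ℕ}

/-- `Y`-position classes of a permuted block. [folklore] -/
theorem posClassY_comp (J : Fin n → ℕ) (σ : Equiv.Perm (Fin n)) (j : ℕ) :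
    posClassY (J ∘ σ) j = (posClassY J j).map σ.symm.toEmbedding := by
  ext t
  rw [mem_map_equiv]
  simp [posClassY]

/-- `Y`-typicalness is invariant under permuting the positions. [cite: AlmanDuanVassilevskaWilliamsXuXuZhou2025, Def. 5.13] -/
theorem isTypicalY_comp_iff (α : ℕ × ℕ × ℕ → ℝ) (γ : ℕ × ℕ × ℕ → (Fin c → Fin 3) → ℝ) (J : Fin n → ℕ)
    (Jh : Fin n → Fin c → Fin 3) (σ : Equiv.Perm (Fin n)) :
    IsTypicalY c α γ (J ∘ σ) (Jh ∘ σ) ↔ IsTypicalY c α γ J Jh := by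
  simp only [IsTypicalY, posClassY_comp, completeSplitOn_comp, map_nonempty]

/-- `Y`-compatibility is invariant under permuting the positions. [cite: AlmanDuanVassilevskaWilliamsXuXuZhou2025, Def. 5.6] -/
theorem isYCompatibleWith_comp_iff (α : ℕ × ℕ × ℕ → ℝ) (γ : ℕ × ℕ × ℕ → (Fin c → Fin 3) → ℝ)
    (I J K : Fin n → ℕ) (Jh : Fin n → Fin c → Fin 3) (σ : Equiv.Perm (Fin n)) :
    IsYCompatibleWith c α γ (I ∘ σ) (J ∘ σ) (K ∘ σ) (Jh ∘ σ) ↔ IsYCompatibleWith c α γ I J K Jh := by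
  simp only [IsYCompatibleWith, posClass_comp, completeSplitOn_comp, map_nonempty, isTypicalY_comp_iff]

end Equivariance

/-! ## The counts of Def. 5.15 / Claim 5.17 -/

namespace GlobalStageData

open scoped Classical

variable {c n M : ℕ} (D : GlobalStageData c n M)

/-- **`C_Y(T)`**: the number of level-1 `Y`-blocks `Y_Ĵ ∈ Y_J` `Y`-compatible with the triple
`T = X_I Y_J Z_K` (quantity `Q` of Claim 5.17's proof, per triple). [cite: AlmanDuanVassilevskaWilliamsXuXuZhou2025, Claim 5.17 (proof, Q)] -/
def compatCountY (T : (Fin n → Fin (2 * c + 1)) × (Fin n → Fin (2 * c + 1)) × (Fin n → Fin (2 * c + 1))) : ℕ :=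
  (univ.filter fun Jh : Fin n → Fin c → Fin 3 => blockOfSeq Jh = T.2.1 ∧ D.YCompatible T Jh).card

/-- **The typical pairs `(Y_J, Y_Ĵ)`**: `J` of type `μ_Y`, `Y_Ĵ ∈ Y_J`, `Ĵ` typical (Def. 5.13).
[cite: AlmanDuanVassilevskaWilliamsXuXuZhou2025, Defs. 5.13 and 5.15] -/
def typicalPairsY : Finset ((Fin n → Fin (2 * c + 1)) × (Fin n → Fin c → Fin 3)) :=
  univ.filter fun p => letterCount p.1 = D.μY ∧ blockOfSeq p.2 = p.1 ∧ IsTypicalY c D.α D.γY (seqVal p.1) p.2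

/-- **The triples of `𝒯α` through `Y_J` that are `Y`-compatible with `Ĵ`** (their number `V_Y(J, Ĵ)` is
`p_compY · numalpha / numyblock`). [cite: AlmanDuanVassilevskaWilliamsXuXuZhou2025, Def. 5.15 and Claim 5.20 (second part)] -/
def compatTriplesY (J : Fin n → Fin (2 * c + 1)) (Jh : Fin n → Fin c → Fin 3) :
    Finset ((Fin n → Fin (2 * c + 1)) × (Fin n → Fin (2 * c + 1)) × (Fin n → Fin (2 * c + 1))) :=
  D.𝒯α.filter fun T' => T'.2.1 = J ∧ D.YCompatible T' Jh

/-- **The pairs (triple of `𝒯α`, `Y`-compatible level-1 block in its `Y`-block)** — the set counted twice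
in Claim 5.17's proof (quantity `Q`). [cite: AlmanDuanVassilevskaWilliamsXuXuZhou2025, Claim 5.17 (proof)] -/
def compatPairsY : Finset (((Fin n → Fin (2 * c + 1)) × (Fin n → Fin (2 * c + 1)) × (Fin n → Fin (2 * c + 1))) ×
    (Fin n → Fin c → Fin 3)) :=
  (D.𝒯α ×ˢ univ).filter fun p => blockOfSeq p.2 = p.1.2.1 ∧ D.YCompatible p.1 p.2

variable {D}

/-- `Y`-compatibility with a permuted triple. [cite: AlmanDuanVassilevskaWilliamsXuXuZhou2025, Def. 5.6] -/
theorem yCompatible_permT_iff (σ : Equiv.Perm (Fin n))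
    (T : (Fin n → Fin (2 * c + 1)) × (Fin n → Fin (2 * c + 1)) × (Fin n → Fin (2 * c + 1)))
    (Jh : Fin n → Fin c → Fin 3) : D.YCompatible (permT σ T) (Jh ∘ σ) ↔ D.YCompatible T Jh :=
  isYCompatibleWith_comp_iff D.α D.γY (seqVal T.1) (seqVal T.2.1) (seqVal T.2.2) Jh σ

/-- **`C_Y` is `S_n`-invariant.** [cite: AlmanDuanVassilevskaWilliamsXuXuZhou2025, Claim 5.17 (proof, "by symmetry")] -/
theorem compatCountY_permT (σ : Equiv.Perm (Fin n))
    (T : (Fin n → Fin (2 * c + 1)) × (Fin n → Fin (2 * c + 1)) × (Fin n → Fin (2 * c + 1))) :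
    D.compatCountY (permT σ T) = D.compatCountY T := by
  unfold compatCountY
  symm
  refine Finset.card_equiv (Equiv.arrowCongr σ.symm (Equiv.refl _)) fun Jh => ?_
  simp only [mem_filter, mem_univ, true_and]
  have e : (Equiv.arrowCongr σ.symm (Equiv.refl (Fin c → Fin 3))) Jh = Jh ∘ σ := by
    funext t; simp [Equiv.arrowCongr_apply]
  rw [e, yCompatible_permT_iff]
  constructor
  · rintro ⟨hb, hc⟩
    exact ⟨by rw [← show (blockOfSeq Jh) ∘ σ = blockOfSeq (Jh ∘ σ) from rfl, hb], hc⟩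
  · rintro ⟨hb, hc⟩
    refine ⟨?_, hc⟩
    have hb' : (blockOfSeq Jh) ∘ σ = T.2.1 ∘ σ := hb
    exact comp_perm_injective σ hb'

/-- **`C_Y` does not depend on the triple of `𝒯α`.** [cite: AlmanDuanVassilevskaWilliamsXuXuZhou2025, Claim 5.17 (proof)] -/
theorem compatCountY_eq_of_mem (hS : D.Symmetric)
    {T T' : (Fin n → Fin (2 * c + 1)) × (Fin n → Fin (2 * c + 1)) × (Fin n → Fin (2 * c + 1))}
    (hT : T ∈ D.𝒯α) (hT' : T' ∈ D.𝒯α) : D.compatCountY T = D.compatCountY T' := by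
  obtain ⟨σ, hσ⟩ := hS.trans T hT T' hT'
  rw [← hσ, compatCountY_permT]

/-- **A typical pair has a determined joint type**: `#{t | J_t = j, Ĵ_t = σ} = β̄_{Y,*,j,*}(σ) · μ_Y(j)`
("For any two different typical level-1 blocks `Y_Ĵ ∈ Y_J` and `Y_Ĵ' ∈ Y_{J'}`, their level-1 complete
split distributions are the same"). [cite: AlmanDuanVassilevskaWilliamsXuXuZhou2025, Def. 5.15 (discussion after Def. 5.16)] -/
theorem letterCount_pairSeq_of_isTypicalY {J : Fin n → Fin (2 * c + 1)} (hJ : letterCount J = D.μY)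
    {Jh : Fin n → Fin c → Fin 3} (htyp : IsTypicalY c D.α D.γY (seqVal J) Jh)
    (a : Fin (2 * c + 1) × (Fin c → Fin 3)) :
    (letterCount (pairSeq J Jh) a : ℝ) = gammaBarY c D.α D.γY a.1 a.2 * D.μY a.1 := by
  have hS : posClassY (seqVal J) (a.1 : ℕ) = univ.filter fun t => J t = a.1 := by
    ext t; simp [posClassY, seqVal, Fin.ext_iff]
  have hcardS : (posClassY (seqVal J) (a.1 : ℕ)).card = D.μY a.1 := by
    rw [hS, ← hJ]; rfl
  have hcount : letterCount (pairSeq J Jh) a = ((posClassY (seqVal J) (a.1 : ℕ)).filter fun t => Jh t = a.2).card := by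
    rw [letterCount_apply, hS, filter_filter]
    congr 1
    ext t
    simp only [mem_filter, mem_univ, true_and, pairSeq, Prod.ext_iff]
  by_cases h0 : D.μY a.1 = 0
  · have hempty : posClassY (seqVal J) (a.1 : ℕ) = ∅ := card_eq_zero.1 (hcardS.trans h0)
    rw [hcount, hempty, filter_empty, card_empty, h0]
    simp
  · have hne : (posClassY (seqVal J) (a.1 : ℕ)).Nonempty :=
      card_pos.1 (by rw [hcardS]; exact Nat.pos_of_ne_zero h0)
    have h := congrFun (htyp a.1 hne) a.2
    simp only [completeSplitOn] at h
    rw [hcardS] at h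
    have hμ : (D.μY a.1 : ℝ) ≠ 0 := by exact_mod_cast h0
    rw [div_eq_iff hμ] at h
    rw [hcount, h]

/-- Any two typical pairs have the same joint type. [cite: AlmanDuanVassilevskaWilliamsXuXuZhou2025, Def. 5.15 (well-definedness)] -/
theorem letterCount_pairSeq_eq_of_mem_typicalPairsY {p p' : (Fin n → Fin (2 * c + 1)) × (Fin n → Fin c → Fin 3)}
    (hp : p ∈ D.typicalPairsY) (hp' : p' ∈ D.typicalPairsY) :
    letterCount (pairSeq p.1 p.2) = letterCount (pairSeq p'.1 p'.2) := by
  obtain ⟨-, hJ, -, ht⟩ := mem_filter.1 hp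
  obtain ⟨-, hJ', -, ht'⟩ := mem_filter.1 hp'
  funext a
  exact_mod_cast (letterCount_pairSeq_of_isTypicalY hJ ht a).trans (letterCount_pairSeq_of_isTypicalY hJ' ht' a).symm

/-- The fibre of the pair set over the word of `(J, Ĵ)` is the set of `Y`-compatible triples through `Y_J`.
[cite: AlmanDuanVassilevskaWilliamsXuXuZhou2025, Claim 5.17 (proof)] -/
theorem card_filter_compatPairsY_eq {J : Fin n → Fin (2 * c + 1)} {Jh : Fin n → Fin c → Fin 3}
    (hJh : blockOfSeq Jh = J) :
    (D.compatPairsY.filter fun q => pairSeq q.1.2.1 q.2 = pairSeq J Jh).card = (D.compatTriplesY J Jh).card := by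
  refine card_bij (fun q _ => q.1) (fun q hq => ?_) (fun q₁ h₁ q₂ h₂ heq => ?_) (fun T' hT' => ?_)
  · obtain ⟨hq, hw⟩ := mem_filter.1 hq
    obtain ⟨hq𝒯, hb, hc⟩ := mem_filter.1 hq
    have h1 : q.1.2.1 = J := funext fun t => congrArg Prod.fst (congrFun hw t)
    have h2 : q.2 = Jh := funext fun t => congrArg Prod.snd (congrFun hw t)
    exact mem_filter.2 ⟨(mem_product.1 hq𝒯).1, h1, h2 ▸ hc⟩
  · obtain ⟨-, hw₁⟩ := mem_filter.1 h₁
    obtain ⟨-, hw₂⟩ := mem_filter.1 h₂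
    have h1 : q₁.2 = Jh := funext fun t => congrArg Prod.snd (congrFun hw₁ t)
    have h2 : q₂.2 = Jh := funext fun t => congrArg Prod.snd (congrFun hw₂ t)
    exact Prod.ext heq (h1.trans h2.symm)
  · obtain ⟨hT'α, hJ, hc⟩ := mem_filter.1 hT'
    refine ⟨(T', Jh), mem_filter.2 ⟨mem_filter.2 ⟨mem_product.2 ⟨hT'α, mem_univ _⟩, ?_, hc⟩, ?_⟩, rfl⟩
    · rw [hJh, hJ]
    · funext t
      simp only [pairSeq, hJ]

/-- **`V_Y(J, Ĵ)` does not depend on the typical pair** (Def. 5.15 is well posed): the pair set is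
`S_n`-stable with an equivariant projection to pair words, and typical pairs have one joint type.
[cite: AlmanDuanVassilevskaWilliamsXuXuZhou2025, Def. 5.15 ("the definition of p_compY is not dependent on the choice of the level-1 block Y_Ĵ, so it is well-defined")] -/
theorem card_compatTriplesY_eq_of_mem (hS : D.Symmetric)
    {p p' : (Fin n → Fin (2 * c + 1)) × (Fin n → Fin c → Fin 3)}
    (hp : p ∈ D.typicalPairsY) (hp' : p' ∈ D.typicalPairsY) :
    (D.compatTriplesY p.1 p.2).card = (D.compatTriplesY p'.1 p'.2).card := by
  have hb : blockOfSeq p.2 = p.1 := (mem_filter.1 hp).2.2.1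
  have hb' : blockOfSeq p'.2 = p'.1 := (mem_filter.1 hp').2.2.1
  rw [← card_filter_compatPairsY_eq hb, ← card_filter_compatPairsY_eq hb']
  refine card_fibre_eq_of_equivariant D.compatPairsY (fun σ q => (permT σ q.1, q.2 ∘ σ))
    (fun q => pairSeq q.1.2.1 q.2) (fun σ q hq => ?_) (fun σ q₁ q₂ h => ?_) (fun σ q => rfl)
    (letterCount_pairSeq_eq_of_mem_typicalPairsY hp hp')
  · obtain ⟨hq𝒯, hbq, hc⟩ := mem_filter.1 hq
    refine mem_filter.2 ⟨mem_product.2 ⟨hS.perm_mem σ _ (mem_product.1 hq𝒯).1, mem_univ _⟩, ?_,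
      (yCompatible_permT_iff σ q.1 q.2).2 hc⟩
    show (blockOfSeq q.2) ∘ σ = q.1.2.1 ∘ σ
    rw [hbq]
  · exact Prod.ext (permTriple_injective σ (congrArg Prod.fst h)) (comp_perm_injective σ (congrArg Prod.snd h))

/-- **Counting the pair set by triples: `|Φ_Y| = |𝒯α| · C_Y`.** [cite: AlmanDuanVassilevskaWilliamsXuXuZhou2025, Claim 5.17 (proof, quantity Q)] -/
theorem card_compatPairsY_eq_mul_compatCountY (hS : D.Symmetric)
    {T₀ : (Fin n → Fin (2 * c + 1)) × (Fin n → Fin (2 * c + 1)) × (Fin n → Fin (2 * c + 1))}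
    (hT₀ : T₀ ∈ D.𝒯α) : D.compatPairsY.card = D.𝒯α.card * D.compatCountY T₀ := by
  unfold compatPairsY
  rw [card_eq_sum_card_fiberwise (f := Prod.fst) (t := D.𝒯α)
    (fun q hq => (mem_product.1 (mem_filter.1 hq).1).1)]
  rw [sum_const_nat (m := D.compatCountY T₀) fun T hT => ?_, mul_comm]
  rw [← compatCountY_eq_of_mem hS hT hT₀, compatCountY]
  refine card_bij (fun q _ => q.2) (fun q hq => ?_) (fun q₁ h₁ q₂ h₂ heq => ?_) (fun Jh hJh => ?_)
  · obtain ⟨hq, hq1⟩ := mem_filter.1 hq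
    obtain ⟨-, hb, hc⟩ := mem_filter.1 hq
    rw [hq1] at hb hc
    exact mem_filter.2 ⟨mem_univ _, hb, hc⟩
  · exact Prod.ext (((mem_filter.1 h₁).2).trans ((mem_filter.1 h₂).2).symm) heq
  · obtain ⟨-, hb, hc⟩ := mem_filter.1 hJh
    exact ⟨(T, Jh), mem_filter.2 ⟨mem_filter.2 ⟨mem_product.2 ⟨hT, mem_univ _⟩, hb, hc⟩, rfl⟩, rfl⟩

/-- **Counting the pair set by typical pairs: `|Φ_Y| = |typeClass n θ_Y| · V_Y`**, `θ_Y` the joint type of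
the typical pairs (every `Y`-compatible block is typical, Def. 5.6 (2)). [cite: AlmanDuanVassilevskaWilliamsXuXuZhou2025, Claim 5.17 (proof, quantity P and the ratio Q/P)] -/
theorem card_compatPairsY_eq_mul_card_compatTriplesY (hS : D.Symmetric)
    (hμ : ∀ T ∈ D.𝒯α, letterCount T.2.1 = D.μY)
    {p₀ : (Fin n → Fin (2 * c + 1)) × (Fin n → Fin c → Fin 3)} (hp₀ : p₀ ∈ D.typicalPairsY) :
    D.compatPairsY.card = (typeClass n (letterCount (pairSeq p₀.1 p₀.2))).card * (D.compatTriplesY p₀.1 p₀.2).card := by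
  have hb₀ : blockOfSeq p₀.2 = p₀.1 := (mem_filter.1 hp₀).2.2.1
  rw [← card_filter_compatPairsY_eq hb₀]
  refine card_eq_card_typeClass_mul_card_fibre D.compatPairsY (fun σ q => (permT σ q.1, q.2 ∘ σ))
    (fun q => pairSeq q.1.2.1 q.2) (fun σ q hq => ?_) (fun σ q₁ q₂ h => ?_) (fun σ q => rfl)
    (fun q hq => ?_) rfl
  · obtain ⟨hq𝒯, hbq, hc⟩ := mem_filter.1 hq
    refine mem_filter.2 ⟨mem_product.2 ⟨hS.perm_mem σ _ (mem_product.1 hq𝒯).1, mem_univ _⟩, ?_,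
      (yCompatible_permT_iff σ q.1 q.2).2 hc⟩
    show (blockOfSeq q.2) ∘ σ = q.1.2.1 ∘ σ
    rw [hbq]
  · exact Prod.ext (permTriple_injective σ (congrArg Prod.fst h)) (comp_perm_injective σ (congrArg Prod.snd h))
  · obtain ⟨hq𝒯, hbq, hc⟩ := mem_filter.1 hq
    have hq' : (q.1.2.1, q.2) ∈ D.typicalPairsY :=
      mem_filter.2 ⟨mem_univ _, hμ _ (mem_product.1 hq𝒯).1, hbq, hc.2⟩
    exact letterCount_pairSeq_eq_of_mem_typicalPairsY hq' hp₀

/-- **ADVXXZ Claim 5.17 as an exact double count**: `V_Y · |typeClass n θ_Y| = |𝒯α| · C_Y` — "`p_compY = Q/P`"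
with `Q = |𝒯α| · C_Y` and `P = |𝒯α| · #{typical Ĵ per Y_J} = #{typical pairs} · (numalpha/numyblock)`,
`#{typical pairs} = |typeClass n θ_Y|` (`card_typicalPairsY_eq`), i.e. `V_Y = p_compY · numalpha / numyblock`.
[cite: AlmanDuanVassilevskaWilliamsXuXuZhou2025, Claim 5.17] -/
theorem advxxz2025_claim517_count (hS : D.Symmetric) (hμ : ∀ T ∈ D.𝒯α, letterCount T.2.1 = D.μY)
    {T₀ : (Fin n → Fin (2 * c + 1)) × (Fin n → Fin (2 * c + 1)) × (Fin n → Fin (2 * c + 1))}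
    (hT₀ : T₀ ∈ D.𝒯α) {p₀ : (Fin n → Fin (2 * c + 1)) × (Fin n → Fin c → Fin 3)} (hp₀ : p₀ ∈ D.typicalPairsY) :
    (D.compatTriplesY p₀.1 p₀.2).card * (typeClass n (letterCount (pairSeq p₀.1 p₀.2))).card =
      D.𝒯α.card * D.compatCountY T₀ := by
  rw [mul_comm, ← card_compatPairsY_eq_mul_card_compatTriplesY hS hμ hp₀,
    card_compatPairsY_eq_mul_compatCountY hS hT₀]

/-- **The typical pairs are in bijection with the words of their joint type** (so
`#{typical pairs} = binom(n; θ_Y)`; the printed "the total number of typical `Y_Ĵ` contained in some `Y_J`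
consistent with `α_Y` is `2^{H(β̄_{Y,*,*,*}) · A₁ n ± o(n)}`"). [cite: AlmanDuanVassilevskaWilliamsXuXuZhou2025, Claim 5.17 (proof, quantity P)] -/
theorem card_typicalPairsY_eq {p₀ : (Fin n → Fin (2 * c + 1)) × (Fin n → Fin c → Fin 3)}
    (hp₀ : p₀ ∈ D.typicalPairsY) :
    D.typicalPairsY.card = (typeClass n (letterCount (pairSeq p₀.1 p₀.2))).card := by
  refine card_bij (fun p _ => pairSeq p.1 p.2) (fun p hp => ?_) (fun p₁ _ p₂ _ h => ?_) (fun w hw => ?_)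
  · rw [mem_typeClass]
    exact letterCount_pairSeq_eq_of_mem_typicalPairsY hp hp₀
  · have h1 : p₁.1 = p₂.1 := funext fun t => congrArg Prod.fst (congrFun h t)
    have h2 : p₁.2 = p₂.2 := funext fun t => congrArg Prod.snd (congrFun h t)
    exact Prod.ext h1 h2
  · rw [mem_typeClass] at hw
    obtain ⟨σ, hσ⟩ := exists_perm_of_letterCount_eq hw
    obtain ⟨-, hJ, hb, ht⟩ := mem_filter.1 hp₀
    refine ⟨(p₀.1 ∘ σ, p₀.2 ∘ σ), mem_filter.2 ⟨mem_univ _, ?_, ?_, ?_⟩, ?_⟩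
    · rw [letterCount_comp_perm, hJ]
    · show (blockOfSeq p₀.2) ∘ σ = p₀.1 ∘ σ
      rw [hb]
    · exact (isTypicalY_comp_iff D.α D.γY (seqVal p₀.1) p₀.2 σ).2 ht
    · funext t
      exact hσ t

/-- **`U_Y(T) ≤ M_Y(T) · V_Y`** (Claim 5.20, second part: "the total number of level-`ℓ` block triples through
`Y_J` that are compatible with `Y_Ĵ`" is `(numalpha/numyblock) · p_compY` for each of the `M_Y(T)` useful
— hence typical — blocks `Ĵ`): the `Y`-hole count of `MoreAsymmetricHoles.lean` is bounded by the number
of useful `Y`-blocks times the common value `V_Y` of `card_compatTriplesY_eq_of_mem`.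
[cite: AlmanDuanVassilevskaWilliamsXuXuZhou2025, Claim 5.20 (second part, proof as in VXXZ Claim 5.16)] -/
theorem card_holePairsY_le (hD : D.WellFormed) (hS : D.Symmetric)
    {T : (Fin n → Fin (2 * c + 1)) × (Fin n → Fin (2 * c + 1)) × (Fin n → Fin (2 * c + 1))}
    (hT : T ∈ D.𝒯α) {p₀ : (Fin n → Fin (2 * c + 1)) × (Fin n → Fin c → Fin 3)} (hp₀ : p₀ ∈ D.typicalPairsY) :
    (D.holePairsY T).card ≤ D.usefulYCount T * (D.compatTriplesY p₀.1 p₀.2).card := by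
  have hT𝒯 := hD.subset hT
  have hlev := isLevelTriple_of_mem_tripleSet hT𝒯
  have hα := hD.alphaConsistent T hT
  have hμT : letterCount T.2.1 = D.μY := (mem_typedSupport.1 hT𝒯).2.1
  rw [holePairsY, card_eq_sum_card_fiberwise (f := Prod.fst)
    (t := univ.filter fun Jh : Fin n → Fin c → Fin 3 => blockOfSeq Jh = T.2.1 ∧ D.UsefulY T Jh)
    (fun q hq => by
      obtain ⟨-, hb, hu, -⟩ := mem_filter.1 hq
      exact mem_filter.2 ⟨mem_univ _, hb, hu⟩)]
  rw [usefulYCount]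
  refine (sum_le_sum (g := fun _ => (D.compatTriplesY p₀.1 p₀.2).card) fun Jh hJh => ?_).trans
    (by rw [sum_const, smul_eq_mul])
  obtain ⟨-, hb, hu⟩ := mem_filter.1 hJh
  have htyp : IsTypicalY c D.α D.γY (seqVal T.2.1) Jh := IsUsefulFor.isTypicalY hlev hα hu
  have hpair : (T.2.1, Jh) ∈ D.typicalPairsY := mem_filter.2 ⟨mem_univ _, hμT, hb, htyp⟩
  rw [← card_compatTriplesY_eq_of_mem hS hpair hp₀]
  refine card_le_card_of_injOn (fun q => q.2) (fun q hq => ?_) (fun q₁ h₁ q₂ h₂ heq => ?_)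
  · rw [mem_coe, mem_filter] at hq
    obtain ⟨hq, hq1⟩ := hq
    obtain ⟨hq𝒯, -, -, -, hJ, hc⟩ := mem_filter.1 hq
    rw [mem_coe, compatTriplesY, mem_filter]
    refine ⟨(mem_product.1 hq𝒯).2, hJ, ?_⟩
    rw [← hq1]; exact hc
  · rw [mem_coe, mem_filter] at h₁ h₂
    exact Prod.ext (h₁.2.trans h₂.2.symm) heq

/-- A useful pair gives a typical pair: for `T ∈ 𝒯α` and `Ĵ ∈ Y_J` useful for `T`, `(J, Ĵ)` is a typical
pair (so `typicalPairsY` is non-empty as soon as some `𝒯*_T` has a level-1 `Y`-block).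
[cite: AlmanDuanVassilevskaWilliamsXuXuZhou2025, Claim 5.12 (proof: usefulness implies typicalness)] -/
theorem mem_typicalPairsY_of_usefulY (hD : D.WellFormed)
    {T : (Fin n → Fin (2 * c + 1)) × (Fin n → Fin (2 * c + 1)) × (Fin n → Fin (2 * c + 1))}
    (hT : T ∈ D.𝒯α) {Jh : Fin n → Fin c → Fin 3} (hb : blockOfSeq Jh = T.2.1) (hu : D.UsefulY T Jh) :
    (T.2.1, Jh) ∈ D.typicalPairsY := by
  have hT𝒯 := hD.subset hT
  exact mem_filter.2 ⟨mem_univ _, (mem_typedSupport.1 hT𝒯).2.1, hb,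
    IsUsefulFor.isTypicalY (isLevelTriple_of_mem_tripleSet hT𝒯) (hD.alphaConsistent T hT) hu⟩

end GlobalStageData

end Literature.Computability.AlgebraicComplexity
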